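/-
Copyright (c) 2026 the pub-hodgecm-mathlib formalisation cell (harness21).  Prover seat hodgecm-mathlib-LH4-p11 (g2), req620 Track A «(D-RAM) FOUR-FRAME» squad
(unit U3_Laws, (R-17) «NI2 ⊕ MS»; THE (MS) COMPOSITION MODULO STAGE B: the registered stub `stub_U3_stableModelSum`'s sentence, token for token, from Stage A ★ (O2c) and
three Stage B inputs taken as ∀-hypotheses in the exact currency of LH4-p10 (g2)'s skeletons (B10 c61f53438acbd4dd ∕ B10₂ 08e5e6e2d02c47d3) and of ★ B9-0 (uniqueness)).  2026-09-04.
-/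
import Summits.HodgeConjecture.HodgeConjecture.Theorems.F0P3cDyRamDiagonalOrbitCount          -- ★ (O2c) p856135 (this seat): Stage A `sum_ncard_fixed_vertices_eq_eight_mul_finsum_stabiliserWeight{,_zero}`; brings ★ TorusDefs, ★ (O1)(O2a)(O2b)
import Summits.HodgeConjecture.HodgeConjecture.Theorems.F0P3cDyRamDiagonalPolarisationCoset   -- ★ B9-0 p856086 (this seat): `hcoset_of_forall_unique`
import Summits.HodgeConjecture.HodgeConjecture.Theorems.F0P3cDyRamDiagonalStrataDefs          -- ★ DEFS p855793 + ED. 2 p856137: `IsTypeTwoPolarisable`, `setOf_mem_and_isTypeTwoPolarisable_eq`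
import Summits.HodgeConjecture.HodgeConjecture.Theorems.F0P3cDyRamFourFrameLawDefs            -- ★ DEFS LEAF №1 p854575: `DyadicFence`; brings ★ #0a `UnitaryThreeFourFrameDefs` (`IsRamifiedQuadraticDatum`, `IsElementDatum`, `depthOfRecord`)
import Literature.NumberTheory.LocalFields.WildQuadraticDatumNonNormUnit                      -- ★ p855483 (LH4-p09 (g2)): `exists_fixed_unit_not_norm_of_v_two_lt_one` (a σ-fixed non-norm unit at every wild datum)
import HarnessLib

/-!
# Crux `H413`, line LH4 «(D-RAM) FOUR-FRAME» road — unit U3_Laws (iii): THE EIGHT-CLASS MODEL SUM (MS) MODULO STAGE B —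
# `stub_U3_stableModelSum`'s sentence from ★ Stage A (O2c), the non-norm unit, and three named Stage B inputs (B10, B10₂, B9-0₂ uniqueness)

Cell `hodgecm-mathlib` (D-0151), FLOOR 0, crux item H413 = `stmt-HodgeConjecture-24833`, route of record `HCCMUnconditional`; squad F0∕P3c∕LH4 (req618∕req620); registered stub served:
`F0P3cDyRamFourFrameU3.stub_U3_stableModelSum` (MS; tree `Cruxes/H413/Lines/F0_P3c_DyRamFourFrame_U3_Laws.lean` ED. 7 :109–:118), through which `stub_U3_stableLaw_RP ∕ _RU`
(EMIT #7∕#8) are PAID by composition (★ p855240).  THEOREMS ONLY (no `def`, no instance, no notation, no `sorry`, default heartbeats); lane `--supports stmt-HodgeConjecture-24833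
--as helper` (count-neutral).  CONDITIONAL ON PROVER TARGETS, NOT ON LITERATURE: the three hypotheses are the Stage B heads of the MS road (empirical census law (S) in
diagonal-model currency), stated VERBATIM as LH4-p10 (g2)'s skeleton sockets; nothing printed is asserted and no `def … : Prop` is introduced.

THE MATHEMATICS (LH4-p10 MEMO-stableLaw-finite v1∕v2; LH4-p11 (g0) BRICKS v2; this seat's MS LEDGER v5).  The MS sentence: behind the dyadic fence `|2| < 1`, at a ramified
quadratic datum `(σ, ϖ, d, t)` over a complete `K` with finite residue field, for a `σ`-fixed unit `c` with the index-two dichotomy, an element datum `(α, β; n₁, n₂, n₃)` at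
threshold `depthOfRecord d`, `T = diag(α, β, 1)`, `2k + d = n₁ + n₂ + n₃ + 2` and `tv ∈ {0, 2}`:
`↑(Σ_{e ∈ (ℤ∕2)³} #{M : M a type-tv vertex lattice of diag(c^{e}), T·M = M}) = 8 · (q^k − 1)∕(q − 1)`.  PROOF (this file, sorry-free over the three inputs):
(1) `c` is a NON-NORM: ★ `WildQuadraticDatum.exists_fixed_unit_not_norm_of_v_two_lt_one` gives a fixed non-norm unit `u₀` (Serre V §3 Cor. 3 for `ℓ = 2`, no completeness);
if `c = zσz` the dichotomy at `u₀` would make `u₀` a norm.  (2) `s = (α, β, 1)` is a REGULAR UNIT DIAGONAL: `|α| = |β| = 1` from `ασα = βσβ = 1` and `v ∘ σ = v`; pairwise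
distinct by the element datum.  (3) STAGE A ★ (O2c): `↑(Σ_e #…) = 8 · Σᶠ_{M₀ ∈ 𝓛₀(T), polarisable_tv} stabiliserWeight σ M₀` — at `tv = 0` unconditionally
(`…stabiliserWeight_zero`, index set `IsDualisableLattice`), at `tv = 2` under the one-coset binder `hcoset`, which ★ B9-0 `hcoset_of_forall_unique` reduces to UNIQUENESS of
the type-2 polarisation up to `S_F(M₀)` at every `M₀ ∈ 𝓛₀(T)` — hypothesis `huniq₂` (delivered stratum-wise by the type-2 twins B4₂∕B5₂∕B7₂ over the shape list B3₂; MEMO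
v2.1 §T2).  (4) STAGE B: `Σᶠ_{𝓛₀(T), dualisable} w = [k]_q` — hypothesis `hB10` = skeleton c61f53438acbd4dd `finsum_stabiliserWeight_dualisable_eq` VERBATIM — and
`Σᶠ_{𝓛₀(T), IsTypeTwoPolarisable} w = [k]_q` — hypothesis `hB10₂` = skeleton 08e5e6e2d02c47d3 `finsum_stabiliserWeight_typeTwoPolarisable_eq` over ★ ED. 2's `IsTypeTwoPolarisable`
(index sets identified by ★ `setOf_mem_and_isTypeTwoPolarisable_eq`, `rfl`).  (5) `8 · [k]_q = 8 · (q^k − 1)∕(q − 1)` (`mul_div_assoc`); `d ≤ depthOfRecord d` (`= d` or `d + 2`).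
So the MS payer `Theorems/F0P3cDyRamStableModelSum.lean :: stableModelSum` is ONE APPLICATION of this theorem to the three ★ heads the hour they land, and the U3 edition pays
`stub_U3_stableModelSum := F0P3cDyRamStableModelSum.stableModelSum` (bare constant), making `stub_U3_stableLaw_RP ∕ _RU` TRIO.

WHAT IS PROVED.
* `not_exists_mul_map_eq_of_dichotomy` — at a wild datum over a finite residue field, a `σ`-fixed unit `c` with the index-two dichotomy is NOT a norm (step (1)).
* `v_vecCons_eq_one_of_isElementDatum`, `vecCons_injective_of_isElementDatum` — step (2): `(α, β, 1)` are pairwise-distinct units.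
* `stableModelSum_of_stageB (hB10) (hB10₂) (huniq₂) : ‹the MS sentence, U3 :109–:118 token for token›` — steps (3)–(5).
HONEST LABEL.  Count-neutral (`--supports`); CONDITIONAL on three PROVER TARGETS (Stage B of the MS road), each a named skeleton socket, none a literature fact; (MS) stays
a PROVER TARGET until they land; `HC_CM` is proved only modulo the 7 printed citations (2 remaining named inputs: hLiu418 = `stmt-HodgeConjecture-24832`, h413 =
`stmt-HodgeConjecture-24833`) until rung 0 closes.

## References
* [Kottwitz1986BaseChangeUnits] R. E. Kottwitz, *Base change for unit elements of Hecke algebras*, Compositio Math. 60 (1986), §1 pp. 240–241 (orbital integrals of units as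
  lattice counts modulo the torus).
* [Rogawski1990] J. D. Rogawski, *Automorphic Representations of Unitary Groups in Three Variables*, Ann. of Math. Stud. 123 (1990), §4.9 Prop. 4.9.1 (a) p. 55.
* [Serre1979] J.-P. Serre, *Local Fields*, GTM 67 (1979), Ch. V §3 Cor. 3 (the unit norm index of a totally ramified cyclic extension of prime degree).
-/

set_option autoImplicit false

noncomputable section

namespace Summit.HodgeConjecture.HodgeConjecture.Cruxes.H413.F0P3cDyRamStableModelSumOfStageB

open scoped Valued WithZero Matrix MatrixGroups
open Literature.NumberTheory.Automorphic Literature.NumberTheory.Automorphic.HermitianLattice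
  Literature.NumberTheory.Automorphic.UnitaryLatticeTree Literature.NumberTheory.Automorphic.UnitaryThreeFourFrame
open Summit.HodgeConjecture.HodgeConjecture.Cruxes.H413.F0P3cDyRamFourFrameLawDefs
open Summit.HodgeConjecture.HodgeConjecture.Cruxes.H413.F0P3cDyRamDiagonalTorusDefs
open Summit.HodgeConjecture.HodgeConjecture.Cruxes.H413.F0P3cDyRamDiagonalStrataDefs
open Summit.HodgeConjecture.HodgeConjecture.Cruxes.H413.F0P3cDyRamDiagonalOrbitCount
open Summit.HodgeConjecture.HodgeConjecture.Cruxes.H413.F0P3cDyRamDiagonalPolarisationCoset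

/-! ## §1  The MS binder `c` is a non-norm -/

/-- **A FIXED UNIT WITH THE INDEX-TWO DICHOTOMY IS NOT A NORM** (wild datum, finite residue field): ★ `WildQuadraticDatum.exists_fixed_unit_not_norm_of_v_two_lt_one` supplies a
`σ`-fixed non-norm unit `u₀`; were `c = zσz`, the dichotomy at `u₀` (`u₀ ∈ N` or `c·u₀ ∈ N`) would make `u₀ = N(y∕z)` a norm.  Serre V §3 Cor. 3 read through the dichotomy.
[cite: Serre1979, Ch. V §3 Cor. 3] [cite: Rogawski1990, §4.9 Prop. 4.9.1 (a) p. 55] -/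
theorem not_exists_mul_map_eq_of_dichotomy {K : Type} [Field K] [Valued K ℤᵐ⁰] [Finite 𝓀[K]] {σ : K →+* K} {ϖ : K} {d t : ℕ}
    (hD : IsRamifiedQuadraticDatum σ ϖ d t) (h2 : Valued.v (2 : K) < 1) {c : K} (hcv : Valued.v c = 1)
    (hdich : ∀ x : K, σ x = x → x ≠ 0 → (∃ z : K, z * σ z = x) ∨ ∃ z : K, z * σ z = c * x) :
    ¬ ∃ z : K, z * σ z = c := by
  obtain ⟨u₀, hσu₀, hu₀v, hu₀⟩ :=
    Literature.NumberTheory.LocalFields.WildQuadraticDatum.exists_fixed_unit_not_norm_of_v_two_lt_one σ ϖ d t hD h2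
  rintro ⟨z, hz⟩
  have hu₀0 : u₀ ≠ 0 := fun h => by rw [h, map_zero] at hu₀v; exact zero_ne_one hu₀v
  rcases hdich u₀ hσu₀ hu₀0 with ⟨y, hy⟩ | ⟨y, hy⟩
  · exact hu₀ ⟨y, hy⟩
  · have hz0 : z ≠ 0 := by
      rintro rfl
      rw [zero_mul] at hz
      rw [← hz, map_zero] at hcv
      exact zero_ne_one hcv
    have hσz0 : σ z ≠ 0 := (map_ne_zero σ).2 hz0
    refine hu₀ ⟨y / z, ?_⟩
    rw [map_div₀, div_mul_div_comm, hy, ← hz]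
    field_simp

/-! ## §2  The element datum gives a regular unit diagonal `(α, β, 1)` -/

/-- **`|α| = |β| = |1| = 1`** for an element datum (`ασα = βσβ = 1`, `v ∘ σ = v`: `|x|² = 1 ⇒ |x| = 1` in `ℤᵐ⁰`). [cite: Rogawski1990, §4.9 Prop. 4.9.1 (a) p. 55] -/
theorem v_vecCons_eq_one_of_isElementDatum {K : Type} [Field K] [Valued K ℤᵐ⁰] {σ : K →+* K} (hvσ : ∀ a, Valued.v (σ a) = Valued.v a)
    {ϖ : K} {N₀ : ℕ} {α β : K} {n₁ n₂ n₃ : ℕ} (hE : IsElementDatum σ ϖ N₀ α β n₁ n₂ n₃) :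
    ∀ i : Fin 3, Valued.v ((![α, β, 1] : Fin 3 → K) i) = 1 := by
  have hv1 : ∀ {x : K}, x * σ x = 1 → Valued.v x = 1 := fun {x} hx => by
    have h : Valued.v x * Valued.v x = 1 := by rw [← hvσ x]; nth_rw 1 [hvσ x]; rw [← map_mul, hx, map_one]
    rw [← pow_two] at h
    exact ((pow_eq_one_iff).1 h).resolve_right two_ne_zero
  intro i
  fin_cases i
  · exact hv1 hE.1
  · exact hv1 hE.2.1
  · exact map_one _

/-- **`α, β, 1` are pairwise distinct** for an element datum (regularity: `α ≠ β`, `α ≠ 1`, `β ≠ 1`). [cite: Rogawski1990, §4.9 Prop. 4.9.1 (a) p. 55] -/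
theorem vecCons_injective_of_isElementDatum {K : Type} [Field K] [Valued K ℤᵐ⁰] {σ : K →+* K}
    {ϖ : K} {N₀ : ℕ} {α β : K} {n₁ n₂ n₃ : ℕ} (hE : IsElementDatum σ ϖ N₀ α β n₁ n₂ n₃) :
    ∀ i j : Fin 3, i ≠ j → (![α, β, 1] : Fin 3 → K) i ≠ (![α, β, 1] : Fin 3 → K) j := by
  have hαβ : α ≠ β := hE.2.2.1
  have hα1 : α ≠ 1 := hE.2.2.2.1
  have hβ1 : β ≠ 1 := hE.2.2.2.2.1
  intro i j hij
  fin_cases i <;> fin_cases j <;> simp [hαβ, hαβ.symm, hα1, hβ1, Ne.symm hα1, Ne.symm hβ1] at hij ⊢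

/-! ## §3  The MS sentence from Stage A ★ and the three Stage B inputs -/

/-- **(MS) MODULO STAGE B — `stub_U3_stableModelSum`'s SENTENCE TOKEN FOR TOKEN** (tree U3 ED. 7 :109–:118), from:
`hB10` — the TYPE-0 STABLE COUNT `Σᶠ_{M ∈ 𝓛₀(T), IsDualisableLattice} stabiliserWeight σ M = (q^k − 1)∕(q − 1)` (skeleton c61f53438acbd4dd `finsum_stabiliserWeight_dualisable_eq`
VERBATIM); `hB10₂` — the TYPE-2 STABLE COUNT over ★ `IsTypeTwoPolarisable` (skeleton 08e5e6e2d02c47d3 `finsum_stabiliserWeight_typeTwoPolarisable_eq`); `huniq₂` — UNIQUENESS of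
type-2 polarisations up to `S_F(M₀)` at every `M₀ ∈ 𝓛₀(T)` (B9-0₂: B3₂ shape list + the twins).  Inside: §1 (non-norm `c`), §2 (regular unit diagonal), ★ (O2c)
`sum_ncard_fixed_vertices_eq_eight_mul_finsum_stabiliserWeight{,_zero}`, ★ `hcoset_of_forall_unique`, ★ `setOf_mem_and_isTypeTwoPolarisable_eq`, `d ≤ depthOfRecord d`,
`8·[k]_q = 8(q^k − 1)∕(q − 1)`. [cite: Kottwitz1986BaseChangeUnits, §1 pp. 240–241] [cite: Rogawski1990, §4.9 Prop. 4.9.1 (a) p. 55] -/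
theorem stableModelSum_of_stageB
    (hB10 : ∀ {K : Type} [Field K] [Valued K ℤᵐ⁰] [Fintype 𝓀[K]] {σ : K →+* K} {ϖ : K} {d t : ℕ}, IsRamifiedQuadraticDatum σ ϖ d t →
      Valued.v (2 : K) < 1 → ∀ {α β : K} {N₀ n₁ n₂ n₃ : ℕ}, IsElementDatum σ ϖ N₀ α β n₁ n₂ n₃ → d ≤ N₀ →
      ∀ (T : GL (Fin 3) K), (T : Matrix (Fin 3) (Fin 3) K) = Matrix.diagonal ![α, β, 1] → ∀ (k : ℕ), 2 * k + d = n₁ + n₂ + n₃ + 2 →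
        ∑ᶠ M ∈ {M | M ∈ normalisedStableLattices T ∧ IsDualisableLattice σ ϖ M}, stabiliserWeight σ M =
          ((Fintype.card 𝓀[K] : ℚ) ^ k - 1) / ((Fintype.card 𝓀[K] : ℚ) - 1))
    (hB10₂ : ∀ {K : Type} [Field K] [Valued K ℤᵐ⁰] [Fintype 𝓀[K]] {σ : K →+* K} {ϖ : K} {d t : ℕ}, IsRamifiedQuadraticDatum σ ϖ d t →
      Valued.v (2 : K) < 1 → ∀ {α β : K} {N₀ n₁ n₂ n₃ : ℕ}, IsElementDatum σ ϖ N₀ α β n₁ n₂ n₃ → d ≤ N₀ →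
      ∀ (T : GL (Fin 3) K), (T : Matrix (Fin 3) (Fin 3) K) = Matrix.diagonal ![α, β, 1] → ∀ (k : ℕ), 2 * k + d = n₁ + n₂ + n₃ + 2 →
        ∑ᶠ M ∈ {M | M ∈ normalisedStableLattices T ∧ IsTypeTwoPolarisable σ ϖ M}, stabiliserWeight σ M =
          ((Fintype.card 𝓀[K] : ℚ) ^ k - 1) / ((Fintype.card 𝓀[K] : ℚ) - 1))
    (huniq₂ : ∀ {K : Type} [Field K] [Valued K ℤᵐ⁰] [Fintype 𝓀[K]] {σ : K →+* K} {ϖ : K} {d t : ℕ}, IsRamifiedQuadraticDatum σ ϖ d t →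
      Valued.v (2 : K) < 1 → ∀ {α β : K} {N₀ n₁ n₂ n₃ : ℕ}, IsElementDatum σ ϖ N₀ α β n₁ n₂ n₃ → d ≤ N₀ →
      ∀ (T : GL (Fin 3) K), (T : Matrix (Fin 3) (Fin 3) K) = Matrix.diagonal ![α, β, 1] →
        ∀ M₀ ∈ normalisedStableLattices T, ∀ D₁ : Fin 3 → K, (∀ i, σ (D₁ i) = D₁ i ∧ D₁ i ≠ 0) →
          IsVertexLattice σ ϖ (Matrix.diagonal D₁) 2 M₀ → ∀ D : Fin 3 → K, (∀ i, σ (D i) = D i ∧ D i ≠ 0) →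
            IsVertexLattice σ ϖ (Matrix.diagonal D) 2 M₀ → ∃ u ∈ fixedUnitStabilizer σ M₀, ∀ i, D i = D₁ i * (u i : Kˣ)) :
    ∀ {K : Type} [Field K] [Valued K ℤᵐ⁰] [CompleteSpace K] [Fintype 𝓀[K]] (σ : K →+* K) (ϖ : K) (d t : ℕ),
      DyadicFence (K := K) (IsRamifiedQuadraticDatum σ ϖ d t →
        ∀ c : K, σ c = c → Valued.v c = 1 → (∀ x : K, σ x = x → x ≠ 0 → (∃ z : K, z * σ z = x) ∨ ∃ z : K, z * σ z = c * x) →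
        ∀ (α β : K) (n₁ n₂ n₃ : ℕ), IsElementDatum σ ϖ (depthOfRecord d) α β n₁ n₂ n₃ →
        ∀ (T : GL (Fin 3) K), (T : Matrix (Fin 3) (Fin 3) K) = Matrix.diagonal ![α, β, 1] →
        ∀ (k : ℕ), 2 * k + d = n₁ + n₂ + n₃ + 2 → ∀ tv : ℕ, tv = 0 ∨ tv = 2 →
          ((∑ s : Fin 3 → Bool, {M : Submodule 𝒪[K] (Fin 3 → K) |
              IsVertexLattice σ ϖ (Matrix.diagonal fun i => if s i then c else (1 : K)) tv M ∧ mapGL T M = M}.ncard : ℕ) : ℚ) =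
            8 * ((Fintype.card 𝓀[K] : ℚ) ^ k - 1) / ((Fintype.card 𝓀[K] : ℚ) - 1)) := by
  intro K _ _ _ _ σ ϖ d t h2 hD c hσc hcv hdich α β n₁ n₂ n₃ hE T hT k hk tv htv
  have hσ : ∀ x, σ (σ x) = x := hD.1
  have hvσ : ∀ a, Valued.v (σ a) = Valued.v a := hD.2.1
  have hϖ : Valued.v ϖ = WithZero.exp (-1 : ℤ) := hD.2.2.1
  -- the schedule of record lies above the datum depth
  have hN₀ : d ≤ depthOfRecord d := by
    unfold depthOfRecord; split_ifs <;> omega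
  -- (1) `c` is a non-norm; (2) the eigenvalues form a regular unit diagonal
  have hc : ¬ ∃ z : K, z * σ z = c := not_exists_mul_map_eq_of_dichotomy hD h2 hcv hdich
  have hs := v_vecCons_eq_one_of_isElementDatum hvσ hE
  have hreg := vecCons_injective_of_isElementDatum hE
  have hϖ0 : ϖ ≠ 0 := (Valuation.ne_zero_iff _).1 (by rw [hϖ]; exact WithZero.exp_ne_zero)
  -- (3) Stage A ★ (O2c), then (4) Stage B, then (5) arithmetic
  rcases htv with rfl | rfl
  · rw [sum_ncard_fixed_vertices_eq_eight_mul_finsum_stabiliserWeight_zero hσ hvσ hϖ (Units.mk0 ϖ hϖ0) rfl hσc hcv hc hdich hs hreg T hT,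
      hB10 hD h2 hE hN₀ T hT k hk, mul_div_assoc]
  · rw [sum_ncard_fixed_vertices_eq_eight_mul_finsum_stabiliserWeight hσ hvσ hϖ (Units.mk0 ϖ hϖ0) rfl hσc hcv hc hdich hs hreg T hT 2
        (hcoset_of_forall_unique σ ϖ T 2 (huniq₂ hD h2 hE hN₀ T hT)),
      setOf_mem_and_isTypeTwoPolarisable_eq, hB10₂ hD h2 hE hN₀ T hT k hk, mul_div_assoc]

/-! ## ED. 2 (append-only; LH4-p11 (g2) RULING 2026-09-04T00:53Z «RE-KEY tv = 2 ON MULTIPLICITY» on LH4-p09 (g2)'s flag, dealer WORD #21, heir LEAD (R-21)):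
§4 the (MS) composition with the TYPE-2 HALF RE-KEYED on the polarisation count `n₂(M) = polarisationCount σ ϖ 2 M` (★ StrataDefs ED. 3) — `huniq₂` is gone; the type-2
inputs are now the Stage A₂ identity WITH MULTIPLICITY (★ OrbitAveraging ED. 2 §6 fed by LH4-p14 (g2)'s (O2b)-MULT) and the B10₂-MULT count `Σᶠ_{𝓛₀(T), pol₂} n₂·w = [k]_q` -/

/-! ## §4  The MS sentence, type-2 half on multiplicity -/

/-- A re-keyed sum over ALL of `𝓛₀(T)` equals the sum over its type-2-polarisable part: `polarisationCount σ ϖ 2 M = 0` off it (★ StrataDefs ED. 3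
`polarisationCount_two_eq_zero_of_not_isTypeTwoPolarisable`). [cite: Kottwitz1986BaseChangeUnits, §1 pp. 240–241] -/
theorem finsum_mem_polarisationCount_mul_eq_finsum_mem_isTypeTwoPolarisable {K : Type} [Field K] [Valued K ℤᵐ⁰] (σ : K →+* K) (ϖ : K)
    (S : Set (Submodule 𝒪[K] (Fin 3 → K))) :
    ∑ᶠ M ∈ S, (polarisationCount σ ϖ 2 M : ℚ) * stabiliserWeight σ M =
      ∑ᶠ M ∈ {M | M ∈ S ∧ IsTypeTwoPolarisable σ ϖ M}, (polarisationCount σ ϖ 2 M : ℚ) * stabiliserWeight σ M := by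
  set f : Submodule 𝒪[K] (Fin 3 → K) → ℚ := fun M => (polarisationCount σ ϖ 2 M : ℚ) * stabiliserWeight σ M with hf
  have hset : S ∩ Function.support f = {M | M ∈ S ∧ IsTypeTwoPolarisable σ ϖ M} ∩ Function.support f := by
    ext M
    simp only [Set.mem_inter_iff, Set.mem_setOf_eq, Function.mem_support]
    constructor
    · rintro ⟨hS, hne⟩
      refine ⟨⟨hS, ?_⟩, hne⟩
      by_contra hpol
      exact hne (by simp only [hf, polarisationCount_two_eq_zero_of_not_isTypeTwoPolarisable σ ϖ M hpol, Nat.cast_zero, zero_mul])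
    · rintro ⟨⟨hS, -⟩, hne⟩
      exact ⟨hS, hne⟩
  rw [← finsum_mem_inter_support f S, hset, finsum_mem_inter_support]

/-- **(MS) MODULO STAGE B, TYPE-2 HALF RE-KEYED ON MULTIPLICITY — `stub_U3_stableModelSum`'s SENTENCE TOKEN FOR TOKEN** (tree U3 ED. 7 :109–:118), from three ∀-closed
inputs: `hB10` — the TYPE-0 STABLE COUNT (★ LH4-p10 (g2) `F0P3cDyRamStableCountTypeZero.finsum_stabiliserWeight_dualisable_eq`, skeleton c61f53438acbd4dd VERBATIM); `hA₂` — STAGE A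
AT TYPE 2 WITH MULTIPLICITY `↑(Σ_e #{M type-2 for diag(c^e), T·M = M}) = 8 · Σᶠ_{M₀ ∈ 𝓛₀(T)} n₂(M₀) · stabiliserWeight σ M₀` (= ★ OrbitAveraging ED. 2 §6
`sum_ncard_fixed_vertices_eq_eight_mul_finsum_mul_stabiliserWeight_of_fibre_identity` at `m := polarisationCount σ ϖ 2` ∘ LH4-p14 (g2)'s (O2b)-MULT — the (O2c)₂-MULT head, filed as
★ OrbitCount ED. 2 once (O2b)-MULT lands); `hB10₂` — the TYPE-2 STABLE COUNT WITH MULTIPLICITY over ALL of `𝓛₀(T)`: `Σᶠ_{M ∈ 𝓛₀(T)} n₂(M) · stabiliserWeight σ M = (q^k − 1)∕(q − 1)` (LH4-p10 (g2)'s B10₂ HEAD v2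
2026-09-04T00:58:37Z; the weight vanishes off the type-2-polarisable part, `finsum_mem_polarisationCount_mul_eq_finsum_mem_isTypeTwoPolarisable`, so the polarisable-part form is one
rewrite away).  Inside: §1 non-norm `c`, §2 regular unit diagonal, ★ (O2c) `…stabiliserWeight_zero` at type 0, `d ≤ depthOfRecord d`, `8·[k]_q = 8(q^k − 1)∕(q − 1)`.
[cite: Kottwitz1986BaseChangeUnits, §1 pp. 240–241] [cite: Rogawski1990, §4.9 Prop. 4.9.1 (a) p. 55] -/
theorem stableModelSum_of_stageB_mult
    (hB10 : ∀ {K : Type} [Field K] [Valued K ℤᵐ⁰] [Fintype 𝓀[K]] {σ : K →+* K} {ϖ : K} {d t : ℕ}, IsRamifiedQuadraticDatum σ ϖ d t →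
      Valued.v (2 : K) < 1 → ∀ {α β : K} {N₀ n₁ n₂ n₃ : ℕ}, IsElementDatum σ ϖ N₀ α β n₁ n₂ n₃ → d ≤ N₀ →
      ∀ (T : GL (Fin 3) K), (T : Matrix (Fin 3) (Fin 3) K) = Matrix.diagonal ![α, β, 1] → ∀ (k : ℕ), 2 * k + d = n₁ + n₂ + n₃ + 2 →
        ∑ᶠ M ∈ {M | M ∈ normalisedStableLattices T ∧ IsDualisableLattice σ ϖ M}, stabiliserWeight σ M =
          ((Fintype.card 𝓀[K] : ℚ) ^ k - 1) / ((Fintype.card 𝓀[K] : ℚ) - 1))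
    (hA₂ : ∀ {K : Type} [Field K] [Valued K ℤᵐ⁰] [Finite 𝓀[K]] {σ : K →+* K}, (∀ x, σ (σ x) = x) → (∀ a, Valued.v (σ a) = Valued.v a) →
      ∀ {ϖ : K}, Valued.v ϖ = WithZero.exp (-1 : ℤ) → ∀ (ϖu : Kˣ), (ϖu : K) = ϖ →
      ∀ {c : K}, σ c = c → Valued.v c = 1 → (¬ ∃ z : K, z * σ z = c) →
      (∀ x : K, σ x = x → x ≠ 0 → (∃ z : K, z * σ z = x) ∨ ∃ z : K, z * σ z = c * x) →
      ∀ {s : Fin 3 → K}, (∀ i, Valued.v (s i) = 1) → (∀ i j, i ≠ j → s i ≠ s j) →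
      ∀ (T : GL (Fin 3) K), (T : Matrix (Fin 3) (Fin 3) K) = Matrix.diagonal s →
        (((∑ e : Fin 3 → Bool, {M : Submodule 𝒪[K] (Fin 3 → K) |
            IsVertexLattice σ ϖ (Matrix.diagonal fun i => if e i then c else (1 : K)) 2 M ∧ mapGL T M = M}.ncard : ℕ) : ℚ)) =
          8 * ∑ᶠ M₀ ∈ normalisedStableLattices T, (polarisationCount σ ϖ 2 M₀ : ℚ) * stabiliserWeight σ M₀)
    (hB10₂ : ∀ {K : Type} [Field K] [Valued K ℤᵐ⁰] [Fintype 𝓀[K]] {σ : K →+* K} {ϖ : K} {d t : ℕ}, IsRamifiedQuadraticDatum σ ϖ d t →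
      Valued.v (2 : K) < 1 → ∀ {α β : K} {N₀ n₁ n₂ n₃ : ℕ}, IsElementDatum σ ϖ N₀ α β n₁ n₂ n₃ → d ≤ N₀ →
      ∀ (T : GL (Fin 3) K), (T : Matrix (Fin 3) (Fin 3) K) = Matrix.diagonal ![α, β, 1] → ∀ (k : ℕ), 2 * k + d = n₁ + n₂ + n₃ + 2 →
        ∑ᶠ M ∈ normalisedStableLattices T, (polarisationCount σ ϖ 2 M : ℚ) * stabiliserWeight σ M =
          ((Fintype.card 𝓀[K] : ℚ) ^ k - 1) / ((Fintype.card 𝓀[K] : ℚ) - 1)) :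
    ∀ {K : Type} [Field K] [Valued K ℤᵐ⁰] [CompleteSpace K] [Fintype 𝓀[K]] (σ : K →+* K) (ϖ : K) (d t : ℕ),
      DyadicFence (K := K) (IsRamifiedQuadraticDatum σ ϖ d t →
        ∀ c : K, σ c = c → Valued.v c = 1 → (∀ x : K, σ x = x → x ≠ 0 → (∃ z : K, z * σ z = x) ∨ ∃ z : K, z * σ z = c * x) →
        ∀ (α β : K) (n₁ n₂ n₃ : ℕ), IsElementDatum σ ϖ (depthOfRecord d) α β n₁ n₂ n₃ →
        ∀ (T : GL (Fin 3) K), (T : Matrix (Fin 3) (Fin 3) K) = Matrix.diagonal ![α, β, 1] →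
        ∀ (k : ℕ), 2 * k + d = n₁ + n₂ + n₃ + 2 → ∀ tv : ℕ, tv = 0 ∨ tv = 2 →
          ((∑ s : Fin 3 → Bool, {M : Submodule 𝒪[K] (Fin 3 → K) |
              IsVertexLattice σ ϖ (Matrix.diagonal fun i => if s i then c else (1 : K)) tv M ∧ mapGL T M = M}.ncard : ℕ) : ℚ) =
            8 * ((Fintype.card 𝓀[K] : ℚ) ^ k - 1) / ((Fintype.card 𝓀[K] : ℚ) - 1)) := by
  intro K _ _ _ _ σ ϖ d t h2 hD c hσc hcv hdich α β n₁ n₂ n₃ hE T hT k hk tv htv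
  have hσ : ∀ x, σ (σ x) = x := hD.1
  have hvσ : ∀ a, Valued.v (σ a) = Valued.v a := hD.2.1
  have hϖ : Valued.v ϖ = WithZero.exp (-1 : ℤ) := hD.2.2.1
  have hN₀ : d ≤ depthOfRecord d := by
    unfold depthOfRecord; split_ifs <;> omega
  have hc : ¬ ∃ z : K, z * σ z = c := not_exists_mul_map_eq_of_dichotomy hD h2 hcv hdich
  have hs := v_vecCons_eq_one_of_isElementDatum hvσ hE
  have hreg := vecCons_injective_of_isElementDatum hE
  have hϖ0 : ϖ ≠ 0 := (Valuation.ne_zero_iff _).1 (by rw [hϖ]; exact WithZero.exp_ne_zero)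
  rcases htv with rfl | rfl
  · rw [sum_ncard_fixed_vertices_eq_eight_mul_finsum_stabiliserWeight_zero hσ hvσ hϖ (Units.mk0 ϖ hϖ0) rfl hσc hcv hc hdich hs hreg T hT,
      hB10 hD h2 hE hN₀ T hT k hk, mul_div_assoc]
  · rw [hA₂ hσ hvσ hϖ (Units.mk0 ϖ hϖ0) rfl hσc hcv hc hdich hs hreg T hT, hB10₂ hD h2 hE hN₀ T hT k hk, mul_div_assoc]

end Summit.HodgeConjecture.HodgeConjecture.Cruxes.H413.F0P3cDyRamStableModelSumOfStageB

end
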